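import Summits.NavierStokesRegularity.NavierStokesRegularity.Theorems.CoriolisHeadLocalEnergyPressureGauge
import Literature.Analysis.FluidPDE.ClassicalSuitableRegionEnergy
import HarnessLib

/-!
# CoriolisHeadLocalEnergyCylinder — crux `NoCoRotatingCore` (stmt-NavierStokesRegularity-22676), line
# `local_energy_rescue` v2.1 (crux workfile, ns-idea-10 g3; unregistered), stub S3a `stub_localEnergyClass` —
# file 5: from slice bounds below the blow-up time to the CKN classes on the cylinder `Q₁(0,0)`

The CKN class of S3a (ii) lives on the OPEN parabolic cylinder `Q₁(0,0) = (−1,0) × B₁`, whose top is the blow-up time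
of the physical rotated self-similar field.  Bounds proved slice by slice for `t < 0` (files 2–4) are turned into the
three integrability statements of the class:

* `lintegral_parabolicCylinder_le_of_forall` — **exhaustion of the cylinder from below**: if a function continuous on
  `(−∞,0) × ℝ³` has `∫⁻_{(−1,t₁) × B₁} F ≤ c` for every `t₁ ∈ (−1,0)`, then `∫⁻_{Q₁(0,0)} F ≤ c` (monotone convergence
  along `t₁ ↑ 0`, `lintegral_iSup'`);
* `lintegral_slab_ball_le` — Tonelli as an inequality on `(−1,t₁) × B₁` (`lintegral_prod_le`);
* `lintegral_cylinder_gradient_le` — the enstrophy class `∫∫_{Q₁} |∇u|² < ∞` from the dissipation bound of file 3;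
* `lintegral_cylinder_pressure_le` — the pressure class `∫∫_{Q₁} |p|^{3/2} < ∞` from the `L^{3/2}` slices of file 4
  and `∫_{−1}^{t₁} λ(s)^{3/2} ds ≤ 4(2a)^{−3/4}`.

HONEST FRAMING.  Helper for an unregistered line's stub (S3a); nothing here proves `NoCoRotatingCore` or NS regularity.

References: L. Caffarelli, R. Kohn, L. Nirenberg, CPAM 35 (1982) §2 (2.1)–(2.5) [CaffarelliKohnNirenberg1982]; T.-P. Tsai,
ARMA 143 (1998) Lemma 4.1 [Tsai1998]; line card `Lines/local_energy_rescue.md` (S3a).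
-/

noncomputable section

open MeasureTheory Set Function Filter Topology Metric InnerProductSpace Real
open scoped RealInnerProductSpace Laplacian ContDiff Topology ENNReal NNReal

-- the summit and its single sub-problem share the name (CONVENTIONS §1), as in every Theorems file
set_option linter.dupNamespace false
-- nested operator types `ℝ³ →L[ℝ] ℝ³` inside the Banach algebra `ℝ³ →L[ℝ] ℝ³` (as in `CoriolisHeadTypeIRateTransport`)
set_option maxSynthPendingDepth 3

namespace Summit.NavierStokesRegularity.NavierStokesRegularity.Theorems.CoriolisHead

namespace LocalEnergyRescue

open Literature.Analysis.FluidPDE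

/-! ## §1 Exhaustion of the cylinder from below and Tonelli -/

/-- **Exhaustion of `Q₁(0,0)` from below.**  If `F` is continuous on `(−∞,0) × ℝ³` and
`∫⁻_{(−1,t₁) × B₁} F ≤ c` for every `t₁ ∈ (−1, 0)`, then `∫⁻_{Q₁(0,0)} F ≤ c`. [folklore] -/
theorem lintegral_parabolicCylinder_le_of_forall {F : ℝ × EuclideanSpace ℝ (Fin 3) → ℝ≥0∞}
    (hF : ContinuousOn F (Iio (0 : ℝ) ×ˢ (univ : Set (EuclideanSpace ℝ (Fin 3))))) {c : ℝ≥0∞}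
    (h : ∀ t₁ : ℝ, -1 < t₁ → t₁ < 0 →
      ∫⁻ z in Ioo (-1 : ℝ) t₁ ×ˢ ball (0 : EuclideanSpace ℝ (Fin 3)) 1, F z ≤ c) :
    ∫⁻ z in parabolicCylinder 1 ((0 : ℝ), (0 : EuclideanSpace ℝ (Fin 3))), F z ≤ c := by
  -- the exhausting sets
  set s : ℕ → Set (ℝ × EuclideanSpace ℝ (Fin 3)) :=
    fun n => Ioo (-1 : ℝ) (-(1 / ((n : ℝ) + 2))) ×ˢ ball (0 : EuclideanSpace ℝ (Fin 3)) 1 with hs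
  have hsm : ∀ n, MeasurableSet (s n) := fun n => measurableSet_Ioo.prod measurableSet_ball
  have hsub : ∀ n, s n ⊆ Iio (0 : ℝ) ×ˢ (univ : Set (EuclideanSpace ℝ (Fin 3))) := fun n z hz => by
    refine ⟨?_, mem_univ _⟩
    have h1 : z.1 < -(1 / ((n : ℝ) + 2)) := (mem_prod.1 hz).1.2
    have h2 : 0 < 1 / ((n : ℝ) + 2) := by positivity
    exact h1.trans (by linarith)
  have hmono : Monotone s := by
    intro n m hnm z hz
    obtain ⟨⟨h1, h2⟩, h3⟩ := mem_prod.1 hz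
    refine mem_prod.2 ⟨⟨h1, lt_of_lt_of_le h2 ?_⟩, h3⟩
    have hnm' : (n : ℝ) + 2 ≤ (m : ℝ) + 2 := by exact_mod_cast Nat.add_le_add_right hnm 2
    exact neg_le_neg (one_div_le_one_div_of_le (by positivity) hnm')
  have hunion : parabolicCylinder 1 ((0 : ℝ), (0 : EuclideanSpace ℝ (Fin 3))) = ⋃ n, s n := by
    ext z
    simp only [parabolicCylinder, mem_iUnion, mem_prod, mem_Ioo, hs]
    constructor
    · rintro ⟨⟨h1, h2⟩, h3⟩
      have h1' : -1 < z.1 := by norm_num at h1; linarith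
      obtain ⟨n, hn⟩ := exists_nat_gt (1 / (-z.1))
      have hz0 : 0 < -z.1 := by linarith
      refine ⟨n, ⟨h1', ?_⟩, h3⟩
      have hn2 : 1 / (-z.1) < (n : ℝ) + 2 := by linarith
      have h4 : 1 / ((n : ℝ) + 2) < -z.1 := by
        rw [div_lt_iff₀ (by positivity)]
        have := (div_lt_iff₀ hz0).1 hn2
        linarith
      linarith
    · rintro ⟨n, ⟨h1, h2⟩, h3⟩
      refine ⟨⟨by norm_num; linarith, h2.trans ?_⟩, h3⟩
      have : 0 < 1 / ((n : ℝ) + 2) := by positivity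
      linarith
  rw [hunion, ← lintegral_indicator (MeasurableSet.iUnion hsm)]
  have hind : ∀ z, (⋃ n, s n).indicator F z = ⨆ n, (s n).indicator F z := fun z =>
    indicator_iUnion_apply (M := ℝ≥0∞) rfl s F z
  simp_rw [hind]
  have hmeas : ∀ n, AEMeasurable (fun z => (s n).indicator F z) volume := fun n =>
    (aemeasurable_indicator_iff (hsm n)).2 ((hF.mono (hsub n)).aemeasurable (hsm n))
  have hmono' : ∀ᵐ z ∂(volume : Measure (ℝ × EuclideanSpace ℝ (Fin 3))), Monotone fun n => (s n).indicator F z :=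
    ae_of_all _ fun z n m hnm => indicator_le_indicator_of_subset (hmono hnm) (fun _ => zero_le) z
  rw [lintegral_iSup' hmeas hmono']
  refine iSup_le fun n => ?_
  rw [lintegral_indicator (hsm n)]
  have h2 : 0 < 1 / ((n : ℝ) + 2) := by positivity
  have h3 : 1 / ((n : ℝ) + 2) < 1 := by
    rw [div_lt_one (by positivity)]; linarith [n.cast_nonneg (α := ℝ)]
  exact h _ (by linarith) (by linarith)

/-- **Tonelli as an inequality on a slab piece**: `∫⁻_{(a,b) × B₁} F ≤ ∫⁻_{t∈(a,b)} ∫⁻_{x∈B₁} F(t,x)`. [folklore] -/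
theorem lintegral_slab_ball_le (F : ℝ × EuclideanSpace ℝ (Fin 3) → ℝ≥0∞) (a b : ℝ) :
    ∫⁻ z in Ioo a b ×ˢ ball (0 : EuclideanSpace ℝ (Fin 3)) 1, F z ≤
      ∫⁻ t in Ioo a b, ∫⁻ x in ball (0 : EuclideanSpace ℝ (Fin 3)) 1, F (t, x) := by
  rw [Measure.volume_eq_prod, ← Measure.prod_restrict]
  exact lintegral_prod_le _

/-- A continuous nonnegative function on `[a, b]`: `∫⁻_{(a,b)} ofReal(g) ≤ ofReal(∫_a^b g)`. [folklore] -/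
theorem lintegral_Ioo_ofReal_le_ofReal_intervalIntegral {g : ℝ → ℝ} {a b : ℝ} (hab : a ≤ b)
    (hg : ContinuousOn g (Icc a b)) (hg0 : ∀ t ∈ Icc a b, 0 ≤ g t) :
    ∫⁻ t in Ioo a b, ENNReal.ofReal (g t) ≤ ENNReal.ofReal (∫ t in a..b, g t) := by
  have hint : IntegrableOn g (Icc a b) volume := hg.integrableOn_compact isCompact_Icc
  rw [intervalIntegral.integral_of_le hab, ← integral_Icc_eq_integral_Ioc,
    ofReal_integral_eq_lintegral_ofReal hint ((ae_restrict_iff' measurableSet_Icc).2 (ae_of_all _ hg0))]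
  exact lintegral_mono_set Ioo_subset_Icc_self

/-! ## §2 The enstrophy class from the dissipation bound -/

section Cylinder

variable {ν a : ℝ} {B : EuclideanSpace ℝ (Fin 3) →L[ℝ] EuclideanSpace ℝ (Fin 3)}
  {U : EuclideanSpace ℝ (Fin 3) → EuclideanSpace ℝ (Fin 3)} {P : EuclideanSpace ℝ (Fin 3) → ℝ}
  {u : ℝ → EuclideanSpace ℝ (Fin 3) → EuclideanSpace ℝ (Fin 3)} {p : ℝ → EuclideanSpace ℝ (Fin 3) → ℝ}

/-- **The enstrophy class on `Q₁(0,0)`** from a dissipation bound: if `(u, p)` is a classical solution on `(−∞, 0)` and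
for a bump `φ ≥ 0`, `φ = 1` on `B(0,1)`, `∫_{−1}^{t₁}∫|∇u|²_F φ ≤ C` for all `t₁ ∈ [−1,0)`, then
`∫⁻_{Q₁(0,0)} |∇u|²_F ≤ ofReal C`. [cite: CaffarelliKohnNirenberg1982, §2 (2.1)] -/
theorem lintegral_cylinder_gradient_le (hNS : IsClassicalNSSolutionOn (Iio 0) ν 0 u p)
    {φ : EuclideanSpace ℝ (Fin 3) → ℝ} (hφc : Continuous φ) (hφs : HasCompactSupport φ) (hφ0 : ∀ x, 0 ≤ φ x)
    (hφ1 : ∀ x ∈ ball (0 : EuclideanSpace ℝ (Fin 3)) 1, φ x = 1) {C : ℝ}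
    (hC : ∀ t₁ : ℝ, -1 ≤ t₁ → t₁ < 0 → ∫ s in (-1 : ℝ)..t₁, ∫ x, frobeniusNormSq (fderiv ℝ (u s) x) * φ x ≤ C) :
    ∫⁻ z in parabolicCylinder 1 ((0 : ℝ), (0 : EuclideanSpace ℝ (Fin 3))),
        ENNReal.ofReal (frobeniusNormSq (fderiv ℝ (u z.1) z.2)) ≤ ENNReal.ofReal C := by
  have hu1 : ContDiffOn ℝ 1 (uncurry u) (Iio (0 : ℝ) ×ˢ univ) := hNS.smooth_velocity.of_le (by norm_cast)
  have cDu : ContinuousOn (fun z : ℝ × EuclideanSpace ℝ (Fin 3) => fderiv ℝ (u z.1) z.2) (Iio (0 : ℝ) ×ˢ univ) :=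
    continuousOn_fderiv_slice_of_contDiffOn hu1 isOpen_Iio.uniqueDiffOn
  have hF : ContinuousOn (fun z : ℝ × EuclideanSpace ℝ (Fin 3) => ENNReal.ofReal (frobeniusNormSq (fderiv ℝ (u z.1) z.2)))
      (Iio (0 : ℝ) ×ˢ univ) :=
    ENNReal.continuous_ofReal.comp_continuousOn (LerayHopfProofs.continuous_frobeniusNormSq.comp_continuousOn cDu)
  refine lintegral_parabolicCylinder_le_of_forall hF fun t₁ ht₁ ht₁0 => ?_
  refine (lintegral_slab_ball_le _ _ _).trans ?_
  -- the slices: `∫⁻_{B₁} |∇u(t)|² ≤ ofReal (∫ |∇u(t)|² φ)`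
  set Φ : ℝ → ℝ := fun t => ∫ x, frobeniusNormSq (fderiv ℝ (u t) x) * φ x with hΦ
  have hslice : ∀ t : ℝ, t < 0 →
      ∫⁻ x in ball (0 : EuclideanSpace ℝ (Fin 3)) 1, ENNReal.ofReal (frobeniusNormSq (fderiv ℝ (u t) x)) ≤
        ENNReal.ofReal (Φ t) := by
    intro t ht
    have ht' : t ∈ Iio (0 : ℝ) := ht
    have hcont : Continuous fun x => frobeniusNormSq (fderiv ℝ (u t) x) :=
      LerayHopfProofs.continuous_frobeniusNormSq.comp
        (((hNS.contDiff_velocity ht').of_le (by norm_cast)).continuous_fderiv one_ne_zero)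
    have hint : Integrable fun x => frobeniusNormSq (fderiv ℝ (u t) x) * φ x :=
      (hcont.mul hφc).integrable_of_hasCompactSupport hφs.mul_left
    rw [hΦ]
    simp only []
    rw [ofReal_integral_eq_lintegral_ofReal hint (ae_of_all _ fun x => mul_nonneg (frobeniusNormSq_nonneg _) (hφ0 x)),
      ← lintegral_indicator measurableSet_ball]
    refine lintegral_mono fun x => ?_
    by_cases hx : x ∈ ball (0 : EuclideanSpace ℝ (Fin 3)) 1
    · rw [indicator_of_mem hx, hφ1 x hx, mul_one]
    · rw [indicator_of_notMem hx]; exact zero_le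
  have hmono : ∫⁻ t in Ioo (-1 : ℝ) t₁, ∫⁻ x in ball (0 : EuclideanSpace ℝ (Fin 3)) 1,
      ENNReal.ofReal (frobeniusNormSq (fderiv ℝ (u t) x)) ≤ ∫⁻ t in Ioo (-1 : ℝ) t₁, ENNReal.ofReal (Φ t) := by
    refine setLIntegral_mono' measurableSet_Ioo fun t ht => hslice t (ht.2.trans ht₁0)
  refine hmono.trans ?_
  -- integrate in time
  have hIcc : Icc (-1 : ℝ) t₁ ⊆ Iio 0 := fun s hs => lt_of_le_of_lt hs.2 ht₁0
  have hΦc : ContinuousOn Φ (Icc (-1 : ℝ) t₁) :=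
    (hNS.continuousOn_integral_dissipation_cutoff isOpen_Iio hφc hφs).mono hIcc
  have hΦ0 : ∀ t ∈ Icc (-1 : ℝ) t₁, 0 ≤ Φ t := fun t _ =>
    integral_nonneg fun x => mul_nonneg (frobeniusNormSq_nonneg _) (hφ0 x)
  refine (lintegral_Ioo_ofReal_le_ofReal_intervalIntegral ht₁.le hΦc hΦ0).trans ?_
  exact ENNReal.ofReal_le_ofReal (hC t₁ ht₁.le ht₁0)

/-! ## §3 The pressure class from the `L^{3/2}` slices -/

/-- `‖x‖ₑ^{3/2} = ofReal(|x|^{3/2})` for real `x`. [folklore] -/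
theorem enorm_rpow_threeHalves_eq_ofReal (x : ℝ) : ‖x‖ₑ ^ (3 / 2 : ℝ) = ENNReal.ofReal (|x| ^ (3 / 2 : ℝ)) := by
  rw [← ofReal_norm, Real.norm_eq_abs, ENNReal.ofReal_rpow_of_nonneg (abs_nonneg _) (by norm_num)]

/-- `∫_{−1}^{t₁} λ(s)^{3/2} ds ≤ 4 (2a)^{−3/4}` for `t₁ ∈ [−1, 0)`. [folklore] -/
theorem integral_scale_rpow_threeHalves_le (ha : 0 < a) {t₁ : ℝ} (ht₁ : -1 ≤ t₁) (ht₁0 : t₁ < 0) :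
    ∫ s in (-1 : ℝ)..t₁, (Real.sqrt (2 * a * (0 - s)))⁻¹ ^ (3 / 2 : ℝ) ≤ 4 * (2 * a) ^ (-(3 / 4 : ℝ)) := by
  have e : ∀ s ∈ uIcc (-1 : ℝ) t₁, (Real.sqrt (2 * a * (0 - s)))⁻¹ ^ (3 / 2 : ℝ) =
      (2 * a) ^ (-(3 / 4 : ℝ)) * (-s) ^ (-(3 / 4 : ℝ)) := by
    intro s hs
    rw [uIcc_of_le ht₁] at hs
    rw [scale_rpow ha (lt_of_le_of_lt hs.2 ht₁0), show (3 / 2 : ℝ) / 2 = 3 / 4 by norm_num]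
  rw [intervalIntegral.integral_congr e, intervalIntegral.integral_const_mul]
  have h := integral_rpow_neg_le (q := 3 / 4) (by norm_num) ht₁ ht₁0
  have h0 : 0 ≤ (2 * a) ^ (-(3 / 4 : ℝ)) := Real.rpow_nonneg (by positivity) _
  calc (2 * a) ^ (-(3 / 4 : ℝ)) * ∫ s in (-1 : ℝ)..t₁, (-s) ^ (-(3 / 4 : ℝ))
      ≤ (2 * a) ^ (-(3 / 4 : ℝ)) * (1 / (1 - 3 / 4)) := mul_le_mul_of_nonneg_left h h0
    _ = 4 * (2 * a) ^ (-(3 / 4 : ℝ)) := by norm_num; ring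

/-- **The pressure class on `Q₁(0,0)`** from `L^{3/2}` slices: if `(u, p)` is a classical solution on `(−∞,0)` with
`p(t) = λ²P'(λe^{−θB}·)` and `∫⁻_{B(0,ρ)}‖P'‖ₑ^{3/2} ≤ ofReal(C₁ρ^{3/2})` for `ρ ≥ 1`, `≤ ofReal C₁` for `0 < ρ < 1`, then
`∫⁻_{Q₁(0,0)} ‖p‖ₑ^{3/2} ≤ ofReal(C₁(4(2a)^{−3/4} + 1))`. [cite: CaffarelliKohnNirenberg1982, §2 (2.3); Lin1998 §3] -/
theorem lintegral_cylinder_pressure_le (ha : 0 < a) (hB : ∀ x, inner ℝ (B x) x = 0)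
    (hNS : IsClassicalNSSolutionOn (Iio 0) ν 0 u p)
    (hp : ∀ t : ℝ, t < 0 → ∀ x : EuclideanSpace ℝ (Fin 3), p t x = (Real.sqrt (2 * a * (0 - t)))⁻¹ ^ 2 *
      P ((Real.sqrt (2 * a * (0 - t)))⁻¹ •
        (NormedSpace.exp ((-(a⁻¹ * Real.log (Real.sqrt (2 * a * (0 - t)))⁻¹)) • B)) x))
    (hPc : Continuous P) {C₁ : ℝ} (hC₁ : 0 ≤ C₁)
    (hbig : ∀ ρ : ℝ, 1 ≤ ρ → ∫⁻ y in ball (0 : EuclideanSpace ℝ (Fin 3)) ρ, ‖P y‖ₑ ^ (3 / 2 : ℝ) ≤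
      ENNReal.ofReal (C₁ * ρ ^ (3 / 2 : ℝ)))
    (hsmall : ∀ ρ : ℝ, 0 < ρ → ρ < 1 → ∫⁻ y in ball (0 : EuclideanSpace ℝ (Fin 3)) ρ, ‖P y‖ₑ ^ (3 / 2 : ℝ) ≤
      ENNReal.ofReal C₁) :
    ∫⁻ z in parabolicCylinder 1 ((0 : ℝ), (0 : EuclideanSpace ℝ (Fin 3))), ‖p z.1 z.2‖ₑ ^ (3 / 2 : ℝ) ≤
      ENNReal.ofReal (C₁ * (4 * (2 * a) ^ (-(3 / 4 : ℝ)) + 1)) := by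
  have hF : ContinuousOn (fun z : ℝ × EuclideanSpace ℝ (Fin 3) => ‖p z.1 z.2‖ₑ ^ (3 / 2 : ℝ))
      (Iio (0 : ℝ) ×ˢ univ) :=
    ENNReal.continuous_rpow_const.comp_continuousOn (continuous_enorm.comp_continuousOn hNS.smooth_pressure.continuousOn)
  refine lintegral_parabolicCylinder_le_of_forall hF fun t₁ ht₁ ht₁0 => ?_
  refine (lintegral_slab_ball_le _ _ _).trans ?_
  -- the slices
  have hslice : ∀ t : ℝ, t < 0 →
      ∫⁻ x in ball (0 : EuclideanSpace ℝ (Fin 3)) 1, ‖p t x‖ₑ ^ (3 / 2 : ℝ) ≤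
        ENNReal.ofReal (C₁ * ((Real.sqrt (2 * a * (0 - t)))⁻¹ ^ (3 / 2 : ℝ) + 1)) := by
    intro t ht
    have ht' : t ∈ Iio (0 : ℝ) := ht
    set lam : ℝ := (Real.sqrt (2 * a * (0 - t)))⁻¹ with hlam
    have hlam0 : 0 < lam := scale_pos ha ht
    have hpc : Continuous (p t) := (hNS.contDiff_pressure ht').continuous
    -- as a Bochner integral, then in similarity variables, then back
    have e1 : ∫⁻ x in ball (0 : EuclideanSpace ℝ (Fin 3)) 1, ‖p t x‖ₑ ^ (3 / 2 : ℝ) =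
        ENNReal.ofReal (∫ x in ball (0 : EuclideanSpace ℝ (Fin 3)) 1, |p t x| ^ (3 / 2 : ℝ)) := by
      simp_rw [enorm_rpow_threeHalves_eq_ofReal]
      exact lintegral_ball_ofReal_eq (hpc.abs.rpow_const fun x => Or.inr (by norm_num))
        (fun x => Real.rpow_nonneg (abs_nonneg _) _) 0 1
    have e2 := setIntegral_ball_abs_rpow_physicalPressure (P := P) ha hB ht (hp t ht) 0 1
    rw [map_zero, smul_zero, one_mul, ← hlam] at e2
    have e3 : ENNReal.ofReal (∫ y in ball (0 : EuclideanSpace ℝ (Fin 3)) lam, |P y| ^ (3 / 2 : ℝ)) =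
        ∫⁻ y in ball (0 : EuclideanSpace ℝ (Fin 3)) lam, ‖P y‖ₑ ^ (3 / 2 : ℝ) := by
      simp_rw [enorm_rpow_threeHalves_eq_ofReal]
      exact (lintegral_ball_ofReal_eq (hPc.abs.rpow_const fun x => Or.inr (by norm_num))
        (fun x => Real.rpow_nonneg (abs_nonneg _) _) 0 lam).symm
    rw [e1, e2, e3]
    have hl32 : 0 ≤ lam ^ (3 / 2 : ℝ) := Real.rpow_nonneg hlam0.le _
    rcases le_or_gt 1 lam with h1 | h1
    · exact (hbig lam h1).trans (ENNReal.ofReal_le_ofReal (by nlinarith))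
    · exact (hsmall lam hlam0 h1).trans (ENNReal.ofReal_le_ofReal (by nlinarith))
  have hmono : ∫⁻ t in Ioo (-1 : ℝ) t₁, ∫⁻ x in ball (0 : EuclideanSpace ℝ (Fin 3)) 1, ‖p t x‖ₑ ^ (3 / 2 : ℝ) ≤
      ∫⁻ t in Ioo (-1 : ℝ) t₁, ENNReal.ofReal (C₁ * ((Real.sqrt (2 * a * (0 - t)))⁻¹ ^ (3 / 2 : ℝ) + 1)) :=
    setLIntegral_mono' measurableSet_Ioo fun t ht => hslice t (ht.2.trans ht₁0)
  refine hmono.trans ?_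
  -- integrate in time
  have hcont : ContinuousOn (fun t : ℝ => C₁ * ((Real.sqrt (2 * a * (0 - t)))⁻¹ ^ (3 / 2 : ℝ) + 1))
      (Icc (-1 : ℝ) t₁) := by
    refine continuousOn_const.mul (ContinuousOn.add ?_ continuousOn_const)
    refine ContinuousOn.rpow_const ?_ fun t _ => Or.inr (by norm_num)
    refine ContinuousOn.inv₀ ((Real.continuous_sqrt.comp (by fun_prop)).continuousOn) fun t ht => ?_
    exact (Real.sqrt_pos.2 (by nlinarith [lt_of_le_of_lt ht.2 ht₁0])).ne'
  have h0 : ∀ t ∈ Icc (-1 : ℝ) t₁, 0 ≤ C₁ * ((Real.sqrt (2 * a * (0 - t)))⁻¹ ^ (3 / 2 : ℝ) + 1) := fun t _ => by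
    have : 0 ≤ (Real.sqrt (2 * a * (0 - t)))⁻¹ ^ (3 / 2 : ℝ) := Real.rpow_nonneg (inv_nonneg.2 (Real.sqrt_nonneg _)) _
    positivity
  refine (lintegral_Ioo_ofReal_le_ofReal_intervalIntegral ht₁.le hcont h0).trans (ENNReal.ofReal_le_ofReal ?_)
  have hint1 : IntervalIntegrable (fun t : ℝ => (Real.sqrt (2 * a * (0 - t)))⁻¹ ^ (3 / 2 : ℝ)) volume (-1) t₁ := by
    refine (ContinuousOn.intervalIntegrable ?_)
    rw [uIcc_of_le ht₁.le]
    refine ContinuousOn.rpow_const ?_ fun t _ => Or.inr (by norm_num)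
    refine ContinuousOn.inv₀ ((Real.continuous_sqrt.comp (by fun_prop)).continuousOn) fun t ht => ?_
    exact (Real.sqrt_pos.2 (by nlinarith [lt_of_le_of_lt ht.2 ht₁0])).ne'
  rw [intervalIntegral.integral_const_mul, intervalIntegral.integral_add hint1 intervalIntegrable_const,
    intervalIntegral.integral_const, smul_eq_mul, mul_one]
  have h1 := integral_scale_rpow_threeHalves_le ha ht₁.le ht₁0
  have h2 : t₁ - -1 ≤ 1 := by linarith
  exact mul_le_mul_of_nonneg_left (by linarith) hC₁

end Cylinder

end LocalEnergyRescue

end Summit.NavierStokesRegularity.NavierStokesRegularity.Theorems.CoriolisHead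

end
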